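import Summits.QuantumFields.BalabanUV.Beta.D1BFx.GhostStencilReflectionQ

/-!
# `BalabanUV.Beta.D1BFx.AveragingJetNeedle` — road «BF-x» for binder row D1, slot (REST′), rows A3.a′∕A3.b′, STRUCTURE ITEM (i) of owner ruling
# ρ-g6-13 (2): THE AXIAL-CONTOUR AVERAGING JET IS NEEDLE-SUPPORTED WITH UNIT MULTIPLICITY — the closed form of the contour coefficient
# `gammaCoeff κ′ u y x ∈ {−1, 0, 1}`, both one-sided vanishing lemmas, the sharp size `|qJet| ≤ n⁻⁴`, and the needle count `n^{κ′+1}` on a block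

HONEST DEPENDENCY (page 1, mandatory): continuum YM on T⁴ ⇐ BetaPertH ∧ nine spine estimates (0/9 proved); BetaPertH ⇐ (D1) ∧ (D4) ∧
CAP+tail; G-an2-4 gates asym, D1 and NE2/3/4.  HONEST FRAMING (cell contract, verbatim): «discharging `BetaPertH` makes Bałaban's UV
stability UNCONDITIONAL — a real constructive-QFT result; it is NOT the continuum limit and NOT the Clay problem.»  THIS MODULE DISCHARGES
NOTHING of the wall: [folklore] finite combinatorics of an1's typed axial contour (`AveragingContours.segUp∕segDown∕seg∕corner∕axialAux∕axial`)
read through the typer's bond indicator `GhostStencil.bondForm` and the jets `GhostStencil.gammaCoeff∕qJet` BY NAME; no `def`, no `def … : Prop`,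
nothing cited, 0 sorry.  0 wall binders; NOT the (REST′) word bounds, NOT (K), NOT D1, NOT `BetaPertH`, NOT continuum, NOT Clay.

ABSOLUTE RULE (cell charter, verbatim): «No internally-minted statement may enter as a cited fact. Every hypothesis is either kernel-proved in
this package or a verbatim quotation of a PUBLISHED theorem with page reference. The manuscript(s) under audit are NOT citable for their own
disputed steps — they are the thing under adjudication; programme-internal (2001/route/tribunal) claims are never citable.»

WHY (owner ruling ρ-g6-13 (2), journal 2026-08-21T00:32:44Z: the projector words A3.a′∕A3.b′ are claimable «WITH the mandatory structure … (i) face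
support of the axial-contour field (`GhostStencilReflectionQ.gammaCoeff_eq_zero_of_lower_ne`) … (iii) the Jq-corner as an explicit rank-1-per-face-bond
operator»; this lineage's BLK-NUM engines (g5, `BLKNUM-RESULT.md` v2) located all growth of the projector words in the `Q̇`-corner on block FACES).
The tree knows the ROOT side of the support (`gammaCoeff_eq_zero_of_lower_ne`: `u_j ≠ y_j` for some `j < κ′` kills the coefficient) and the crude size
`|qJet| ≤ 4/n³` (`GhostStencil.abs_qJet_le`).  The bond `⟨u, u + e_κ′⟩` is met by the corner-rooted contour `Γ_{y,x}` only inside its direction-`κ′`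
segment, which runs from `corner y x (κ′+1)` (coordinates `< κ′` the root's, `> κ′` the endpoint's) by `x_κ′ − y_κ′` monotone steps; hence the
coefficient is `+1`, `−1` or `0` according to an EXPLICIT needle condition, and every consequence below is read off that closed form.

CONTENT (all [folklore]; `d = 4`, `Site 4 = ℤ⁴`, block side `n` in road units, `blk = B6QGQLower276.blk (n−1)`):
* §1 `add_zsmul_unitVec_eq_iff`, `sub_zsmul_unitVec_eq_iff` (a lattice line meets a point in one explicit parameter); **`sum_segUp_bondForm`**,
  **`sum_segDown_bondForm`**, **`sum_seg_bondForm`** — the letter sum of the bond indicator along a straight segment is the indicator of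
  «same direction, on the line, parameter in range» (with sign `−1` for backward traversal).
* §2 `sum_axialAux_bondForm` (only the direction-`κ′` segment sees the bond), **`gammaCoeff_eq_sum_seg`**, **`gammaCoeff_eq_ite`** (THE CLOSED FORM:
  `gammaCoeff κ′ u y x = ±1` iff `u_j = y_j (j < κ′)`, `u_j = x_j (j > κ′)` and `u_κ′ ∈ [y_κ′, x_κ′)` resp. `[x_κ′, y_κ′)`, else `0`),
  `abs_gammaCoeff_le_one`, **`gammaCoeff_eq_zero_of_upper_ne`** (the ENDPOINT-side twin of the tree's root-side lemma), `gammaCoeff_nonneg_of_le`,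
  `gammaCoeff_le_one`.
* §3 the jet: **`abs_qJet_le_inv_pow_four`** (`|qJet n κ′ u y x| ≤ (n⁴)⁻¹`, sharp), `qJet_eq_zero_of_upper_ne` (needle support in the endpoint),
  `qJet_nonneg` (the root `n•y` lies below its block), `qJet_le_indicator`; the NEEDLE COUNT `card_needle_le` (`#{z : cube | z_j pinned for j > κ′} ≤ n^{κ′+1}`)
  and **`sum_B_abs_qJet_le`**: `Σ_{x ∈ B(y)} |qJet n κ′ u y x| ≤ n^{κ′+1}·(n⁴)⁻¹` — the face∕needle weight `n^{κ′−3}` of one background bond.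
Provenance: D1 formalisation swarm, unit b2b-balaban-beta-d1-formalise-leaf-04 gen 6 (prover-b2b-balaban-beta-d1-formalise-leaf-04-g6-0), 2026-08-21;
sub-leaf «D1-BFx-A3a′-NEEDLE» of `LEAVES-BFx.md` (structure items (i)+(iii) only).
-/

namespace Summit.QuantumFields.BalabanUV.Beta.D1BFx.AveragingJetNeedle

open Finset
open scoped BigOperators
open Literature.MathematicalPhysics.QuantumFieldTheory.Balaban1983to89
open Literature.MathematicalPhysics.QuantumFieldTheory.Balaban1983to89.Beta
open B6QGQLower276 (blk loc side B chart sum_B blk_chart side_mul_blk_add_loc loc_nonneg loc_lt)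
open ExpKernelCalculus (Site)
open AffineAveraging (Form1 unitVec unitVec_apply)
open AveragingContours (seg segUp segDown corner axialAux axial segUp_zero segUp_succ segDown_zero segDown_succ)
open GhostLeg (side_pred)
open GhostStencil (bondForm gammaCoeff qJet qJet_eq_zero mem_block_of_blk_eq)

noncomputable section

/-! ## §1 Letter sums of the bond indicator along straight segments -/

/-- [folklore] A lattice line `z + ℤ·e_κ` meets the point `u` at the parameter `u_κ − z_κ`, and only if `z`, `u` agree off the coordinate `κ`. -/
theorem add_zsmul_unitVec_eq_iff (z u : Site 4) (κ : Fin 4) (s : ℤ) :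
    z + s • unitVec κ = u ↔ (∀ j : Fin 4, j ≠ κ → z j = u j) ∧ z κ + s = u κ := by
  constructor
  · intro h
    have hj : ∀ j : Fin 4, z j + s * (if j = κ then (1 : ℤ) else 0) = u j := fun j => by
      have := congr_fun h j
      simpa [unitVec_apply] using this
    refine ⟨fun j hjk => ?_, ?_⟩
    · have := hj j
      rw [if_neg hjk, mul_zero, add_zero] at this
      exact this
    · have := hj κ
      rw [if_pos rfl, mul_one] at this
      exact this
  · rintro ⟨h1, h2⟩
    funext j
    by_cases hjk : j = κ
    · subst hjk
      simp [unitVec_apply, h2.symm]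
    · simp [unitVec_apply, hjk, h1 j hjk]

/-- [folklore] The same for the backward line `z − ℤ·e_κ`. -/
theorem sub_zsmul_unitVec_eq_iff (z u : Site 4) (κ : Fin 4) (s : ℤ) :
    z - s • unitVec κ = u ↔ (∀ j : Fin 4, j ≠ κ → z j = u j) ∧ z κ - s = u κ := by
  rw [sub_eq_add_neg, ← neg_smul, add_zsmul_unitVec_eq_iff]
  simp only [← sub_eq_add_neg]

/-- [folklore] **FORWARD SEGMENT**: the letters of `bondForm κ′ u` along the `m` bonds from `z` in direction `+κ` sum to the indicator of
«`κ = κ′`, `z` and `u` agree off `κ`, and `z_κ ≤ u_κ < z_κ + m`» (the bond is traversed at most once). -/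
theorem sum_segUp_bondForm (κ' κ : Fin 4) (u z : Site 4) (m : ℕ) :
    (segUp (bondForm κ' u) z κ m).sum =
      if κ = κ' ∧ (∀ j : Fin 4, j ≠ κ → z j = u j) ∧ z κ ≤ u κ ∧ u κ < z κ + m then (1 : ℝ) else 0 := by
  induction m with
  | zero =>
    rw [segUp_zero, List.sum_nil]
    split_ifs with h
    · exfalso; push_cast at h; omega
    · rfl
  | succ m ih =>
    rw [segUp_succ, List.sum_append, List.sum_singleton, ih]
    have hb : bondForm κ' u κ (z + ((m : ℕ) : ℤ) • unitVec κ) =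
        if κ = κ' ∧ (∀ j : Fin 4, j ≠ κ → z j = u j) ∧ z κ + m = u κ then (1 : ℝ) else 0 := by
      unfold bondForm
      by_cases h : κ = κ' ∧ (∀ j : Fin 4, j ≠ κ → z j = u j) ∧ z κ + m = u κ
      · rw [if_pos h, if_pos ⟨h.1, (add_zsmul_unitVec_eq_iff z u κ m).2 h.2⟩]
      · rw [if_neg h, if_neg (fun h' => h ⟨h'.1, (add_zsmul_unitVec_eq_iff z u κ m).1 h'.2⟩)]
    rw [hb]
    push_cast
    by_cases hk : κ = κ' ∧ (∀ j : Fin 4, j ≠ κ → z j = u j)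
    · obtain ⟨hkk, hl⟩ := hk
      subst hkk
      by_cases h1 : z κ ≤ u κ ∧ u κ < z κ + m
      · rw [if_pos ⟨rfl, hl, h1⟩, if_neg (fun h => by have := h.2.2; omega), if_pos ⟨rfl, hl, by omega⟩, add_zero]
      · rw [if_neg (fun h => h1 h.2.2)]
        by_cases h2 : z κ + m = u κ
        · rw [if_pos ⟨rfl, hl, h2⟩, if_pos ⟨rfl, hl, by omega⟩, zero_add]
        · rw [if_neg (fun h => h2 h.2.2), if_neg (fun h => by have := h.2.2; omega), add_zero]
    · rw [if_neg (fun h => hk ⟨h.1, h.2.1⟩), if_neg (fun h => hk ⟨h.1, h.2.1⟩), if_neg (fun h => hk ⟨h.1, h.2.1⟩), add_zero]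

/-- [folklore] **BACKWARD SEGMENT**: along the `m` bonds from `z` in direction `−κ` the letters of `bondForm κ′ u` sum to MINUS the indicator of
«`κ = κ′`, agreement off `κ`, and `z_κ − m ≤ u_κ < z_κ`». -/
theorem sum_segDown_bondForm (κ' κ : Fin 4) (u z : Site 4) (m : ℕ) :
    (segDown (bondForm κ' u) z κ m).sum =
      if κ = κ' ∧ (∀ j : Fin 4, j ≠ κ → z j = u j) ∧ z κ - m ≤ u κ ∧ u κ < z κ then (-1 : ℝ) else 0 := by
  induction m with
  | zero =>
    rw [segDown_zero, List.sum_nil]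
    split_ifs with h
    · exfalso; push_cast at h; omega
    · rfl
  | succ m ih =>
    rw [segDown_succ, List.sum_append, List.sum_singleton, ih]
    have hb : bondForm κ' u κ (z - (((m : ℕ) : ℤ) + 1) • unitVec κ) =
        if κ = κ' ∧ (∀ j : Fin 4, j ≠ κ → z j = u j) ∧ z κ - (m + 1) = u κ then (1 : ℝ) else 0 := by
      unfold bondForm
      by_cases h : κ = κ' ∧ (∀ j : Fin 4, j ≠ κ → z j = u j) ∧ z κ - (m + 1) = u κ
      · rw [if_pos h, if_pos ⟨h.1, (sub_zsmul_unitVec_eq_iff z u κ (m + 1)).2 h.2⟩]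
      · rw [if_neg h, if_neg (fun h' => h ⟨h'.1, (sub_zsmul_unitVec_eq_iff z u κ (m + 1)).1 h'.2⟩)]
    rw [hb]
    push_cast
    by_cases hk : κ = κ' ∧ (∀ j : Fin 4, j ≠ κ → z j = u j)
    · obtain ⟨hkk, hl⟩ := hk
      subst hkk
      by_cases h1 : z κ - m ≤ u κ ∧ u κ < z κ
      · rw [if_pos ⟨rfl, hl, h1⟩, if_neg (fun h => by have := h.2.2; omega), if_pos ⟨rfl, hl, by omega⟩, neg_zero,
          add_zero]
      · rw [if_neg (fun h => h1 h.2.2)]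
        by_cases h2 : z κ - (m + 1) = u κ
        · rw [if_pos ⟨rfl, hl, h2⟩, if_pos ⟨rfl, hl, by omega⟩, zero_add]
        · rw [if_neg (fun h => h2 h.2.2), if_neg (fun h => by have := h.2.2; omega), neg_zero, add_zero]
    · rw [if_neg (fun h => hk ⟨h.1, h.2.1⟩), if_neg (fun h => hk ⟨h.1, h.2.1⟩), if_neg (fun h => hk ⟨h.1, h.2.1⟩), neg_zero,
        add_zero]

/-- [folklore] **SIGNED SEGMENT** from `z` to `z + t·e_κ` (`t : ℤ`): the letters of `bondForm κ′ u` sum to `+1` if the bond lies on the segment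
traversed forward (`z_κ ≤ u_κ < z_κ + t`), `−1` if backward (`z_κ + t ≤ u_κ < z_κ`), `0` otherwise. -/
theorem sum_seg_bondForm (κ' κ : Fin 4) (u z : Site 4) (t : ℤ) :
    (seg (bondForm κ' u) z κ t).sum =
      if κ = κ' ∧ (∀ j : Fin 4, j ≠ κ → z j = u j) then
        (if z κ ≤ u κ ∧ u κ < z κ + t then (1 : ℝ) else if z κ + t ≤ u κ ∧ u κ < z κ then -1 else 0)
      else 0 := by
  unfold seg
  by_cases hk : κ = κ' ∧ (∀ j : Fin 4, j ≠ κ → z j = u j)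
  · rw [if_pos hk]
    by_cases ht : 0 ≤ t
    · rw [if_pos ht, sum_segUp_bondForm]
      have e : (((t.toNat : ℕ) : ℤ)) = t := Int.toNat_of_nonneg ht
      by_cases h1 : z κ ≤ u κ ∧ u κ < z κ + t
      · rw [if_pos ⟨hk.1, hk.2, by rw [e]; exact h1⟩, if_pos h1]
      · rw [if_neg (fun h => h1 (by rw [← e]; exact h.2.2)), if_neg h1, if_neg (fun h => by omega)]
    · rw [if_neg ht, sum_segDown_bondForm]
      have e : ((((-t).toNat : ℕ) : ℤ)) = -t := Int.toNat_of_nonneg (by omega)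
      have hne : ¬(z κ ≤ u κ ∧ u κ < z κ + t) := fun h => by omega
      rw [if_neg hne]
      by_cases h1 : z κ + t ≤ u κ ∧ u κ < z κ
      · rw [if_pos ⟨hk.1, hk.2, by rw [e]; constructor <;> omega⟩, if_pos h1]
      · rw [if_neg (fun h => h1 (by rw [e] at h; constructor <;> omega)), if_neg h1]
  · rw [if_neg hk]
    split_ifs
    · rw [sum_segUp_bondForm, if_neg (fun h => hk ⟨h.1, h.2.1⟩)]
    · rw [sum_segDown_bondForm, if_neg (fun h => hk ⟨h.1, h.2.1⟩)]

/-! ## §2 The contour coefficient in closed form -/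

/-- [folklore] Only the direction-`κ′` segment of the partial contour `axialAux · y x m` (directions `m−1, …, 0`) can meet an axis-`κ′` bond:
the letter sum of `bondForm κ′ u` over it is the direction-`κ′` segment's if `κ′ < m`, and `0` otherwise. -/
theorem sum_axialAux_bondForm (κ' : Fin 4) (u y x : Site 4) :
    ∀ m : ℕ, m ≤ 4 → (axialAux (bondForm κ' u) y x m).sum =
      if (κ' : ℕ) < m then (seg (bondForm κ' u) (corner y x ((κ' : ℕ) + 1)) κ' (x κ' - y κ')).sum else 0
  | 0, _ => by simp [axialAux]
  | m + 1, hm => by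
    have h : m < 4 := by omega
    have ih := sum_axialAux_bondForm κ' u y x m (by omega)
    simp only [axialAux, h, dif_pos, List.sum_append]
    rw [ih]
    by_cases hmk : m = (κ' : ℕ)
    · subst hmk
      simp only [Fin.eta, lt_add_iff_pos_right, Nat.lt_one_iff, pos_of_gt, if_true, lt_self_iff_false, if_false, add_zero]
    · have hne : (⟨m, h⟩ : Fin 4) ≠ κ' := fun e => hmk (by rw [← e])
      rw [sum_seg_bondForm, if_neg (fun hh => hne hh.1), zero_add]
      by_cases hlt : (κ' : ℕ) < m
      · rw [if_pos hlt, if_pos (by omega)]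
      · rw [if_neg hlt, if_neg (by omega)]

/-- [folklore] **THE COEFFICIENT IS ONE SEGMENT SUM**: `gammaCoeff κ′ u y x` = the letter sum of the bond indicator along the direction-`κ′`
segment of `Γ_{y,x}`, which starts at `corner y x (κ′+1)` and makes `x_κ′ − y_κ′` signed steps. -/
theorem gammaCoeff_eq_sum_seg (κ' : Fin 4) (u y x : Site 4) :
    gammaCoeff κ' u y x = (seg (bondForm κ' u) (corner y x ((κ' : ℕ) + 1)) κ' (x κ' - y κ')).sum := by
  unfold gammaCoeff axial
  rw [sum_axialAux_bondForm κ' u y x 4 le_rfl, if_pos κ'.2]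

/-- [folklore] Coordinates of the corner where the direction-`κ′` segment starts: the endpoint's above `κ′`, the root's at and below `κ′`. -/
theorem corner_succ_apply (y x : Site 4) (κ' j : Fin 4) :
    corner y x ((κ' : ℕ) + 1) j = if (κ' : ℕ) < j then x j else y j := by
  unfold corner
  by_cases h : (κ' : ℕ) < j
  · rw [if_pos h, if_pos (by omega)]
  · rw [if_neg h, if_neg (by omega)]

/-- [folklore] The line condition at that corner is the NEEDLE CONDITION: agreement with the root below `κ′` and with the endpoint above `κ′`. -/
theorem corner_line_iff (κ' : Fin 4) (u y x : Site 4) :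
    (∀ j : Fin 4, j ≠ κ' → corner y x ((κ' : ℕ) + 1) j = u j) ↔
      (∀ j : Fin 4, (j : ℕ) < κ' → u j = y j) ∧ (∀ j : Fin 4, (κ' : ℕ) < j → u j = x j) := by
  constructor
  · intro h
    refine ⟨fun j hj => ?_, fun j hj => ?_⟩
    · have hne : j ≠ κ' := fun e => by rw [e] at hj; exact lt_irrefl _ hj
      have := h j hne
      rw [corner_succ_apply, if_neg (by omega)] at this
      exact this.symm
    · have hne : j ≠ κ' := fun e => by rw [e] at hj; exact lt_irrefl _ hj
      have := h j hne
      rw [corner_succ_apply, if_pos hj] at this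
      exact this.symm
  · rintro ⟨h1, h2⟩ j hj
    rw [corner_succ_apply]
    have hj' : (j : ℕ) ≠ κ' := fun e => hj (Fin.ext e)
    by_cases hlt : (κ' : ℕ) < j
    · rw [if_pos hlt]; exact (h2 j hlt).symm
    · rw [if_neg hlt]; exact (h1 j (by omega)).symm

/-- [folklore] **THE CLOSED FORM OF THE CONTOUR COEFFICIENT.**  The signed multiplicity of the bond `⟨u, u + e_κ′⟩` in the corner-rooted axial
contour `Γ_{y,x}` is: `0` unless `u_j = y_j` for all `j < κ′` and `u_j = x_j` for all `j > κ′` (the NEEDLE); on the needle it is `+1` if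
`y_κ′ ≤ u_κ′ < x_κ′`, `−1` if `x_κ′ ≤ u_κ′ < y_κ′`, and `0` otherwise. -/
theorem gammaCoeff_eq_ite (κ' : Fin 4) (u y x : Site 4) :
    gammaCoeff κ' u y x =
      if (∀ j : Fin 4, (j : ℕ) < κ' → u j = y j) ∧ (∀ j : Fin 4, (κ' : ℕ) < j → u j = x j) then
        (if y κ' ≤ u κ' ∧ u κ' < x κ' then (1 : ℝ) else if x κ' ≤ u κ' ∧ u κ' < y κ' then -1 else 0)
      else 0 := by
  rw [gammaCoeff_eq_sum_seg, sum_seg_bondForm]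
  have hc : corner y x ((κ' : ℕ) + 1) κ' = y κ' := by rw [corner_succ_apply, if_neg (lt_irrefl _)]
  rw [hc]
  by_cases hN : (∀ j : Fin 4, (j : ℕ) < κ' → u j = y j) ∧ (∀ j : Fin 4, (κ' : ℕ) < j → u j = x j)
  · rw [if_pos ⟨rfl, (corner_line_iff κ' u y x).2 hN⟩, if_pos hN]
    have e : y κ' + (x κ' - y κ') = x κ' := by ring
    rw [e]
  · rw [if_neg (fun h => hN ((corner_line_iff κ' u y x).1 h.2)), if_neg hN]

/-- [folklore] **UNIT MULTIPLICITY**: `|gammaCoeff κ′ u y x| ≤ 1`. -/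
theorem abs_gammaCoeff_le_one (κ' : Fin 4) (u y x : Site 4) : |gammaCoeff κ' u y x| ≤ 1 := by
  rw [gammaCoeff_eq_ite]
  split_ifs <;> norm_num

/-- [folklore] **ENDPOINT-SIDE NEEDLE SUPPORT** (twin of the tree's root-side `gammaCoeff_eq_zero_of_lower_ne`): if `u_j ≠ x_j` for some
coordinate `j > κ′`, the bond `⟨u, u + e_κ′⟩` is not met by `Γ_{y,x}` — for EVERY root `y`. -/
theorem gammaCoeff_eq_zero_of_upper_ne (κ' : Fin 4) {u x : Site 4} (j : Fin 4) (hj : (κ' : ℕ) < j) (hne : u j ≠ x j) (y : Site 4) :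
    gammaCoeff κ' u y x = 0 := by
  rw [gammaCoeff_eq_ite, if_neg]
  exact fun h => hne (h.2 j hj)

/-- [folklore] For a root below the endpoint in the coordinate `κ′` the coefficient is `0` or `1`: non-negative … -/
theorem gammaCoeff_nonneg_of_le (κ' : Fin 4) (u : Site 4) {y x : Site 4} (h : y κ' ≤ x κ') : 0 ≤ gammaCoeff κ' u y x := by
  rw [gammaCoeff_eq_ite]
  split_ifs with h1 h2 h3
  · norm_num
  · exfalso; omega
  · norm_num
  · norm_num

/-- [folklore] … and at most `1`. -/
theorem gammaCoeff_le_one (κ' : Fin 4) (u y x : Site 4) : gammaCoeff κ' u y x ≤ 1 :=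
  (le_abs_self _).trans (abs_gammaCoeff_le_one κ' u y x)

/-! ## §3 The averaging jet: sharp size, needle support, needle count -/

variable (n : ℕ) [NeZero n] (κ' : Fin 4) (u : Site 4)

/-- [folklore] **SHARP SIZE OF THE JET**: `|qJet n κ′ u y x| ≤ (n⁴)⁻¹` (the weight `n⁻⁴` times a multiplicity of modulus `≤ 1`; the tree's
`GhostStencil.abs_qJet_le` gives `4/n³`). -/
theorem abs_qJet_le_inv_pow_four (y x : Site 4) : |qJet n κ' u y x| ≤ ((n : ℝ) ^ 4)⁻¹ := by
  have hn : (0 : ℝ) < n := Nat.cast_pos.mpr (Nat.pos_of_ne_zero (NeZero.ne n))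
  unfold qJet
  split_ifs with h
  · rw [abs_mul, abs_inv, abs_of_pos (pow_pos hn 4)]
    have h1 := abs_gammaCoeff_le_one κ' u ((n : ℤ) • y) x
    calc ((n : ℝ) ^ 4)⁻¹ * |gammaCoeff κ' u ((n : ℤ) • y) x| ≤ ((n : ℝ) ^ 4)⁻¹ * 1 :=
          mul_le_mul_of_nonneg_left h1 (inv_nonneg.mpr (pow_pos hn 4).le)
      _ = ((n : ℝ) ^ 4)⁻¹ := mul_one _
  · rw [abs_zero]; positivity

omit [NeZero n] in
/-- [folklore] **NEEDLE SUPPORT OF THE JET IN ITS FINE ARGUMENT**: `qJet n κ′ u y x = 0` unless `x_j = u_j` for every coordinate `j > κ′`. -/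
theorem qJet_eq_zero_of_upper_ne {x : Site 4} (j : Fin 4) (hj : (κ' : ℕ) < j) (hne : u j ≠ x j) (y : Site 4) :
    qJet n κ' u y x = 0 := by
  unfold qJet
  split_ifs with h
  · rw [gammaCoeff_eq_zero_of_upper_ne κ' j hj hne, mul_zero]
  · rfl

/-- [folklore] The scaled block label lies below the site: `(n•blk x)_κ ≤ x_κ` (Euclidean division, block side `n`). -/
theorem smul_blk_apply_le (x : Site 4) (κ : Fin 4) : ((n : ℤ) • blk (n - 1) x) κ ≤ x κ := by
  have h := (mem_block_of_blk_eq n (rfl : blk (n - 1) x = blk (n - 1) x) κ).1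
  linarith

/-- [folklore] **THE JET IS NON-NEGATIVE**: the root `n•y` of the block `B(y)` lies below every site of the block, so the bond is met forward or
not at all. -/
theorem qJet_nonneg (y x : Site 4) : 0 ≤ qJet n κ' u y x := by
  have hn : (0 : ℝ) < n := Nat.cast_pos.mpr (Nat.pos_of_ne_zero (NeZero.ne n))
  unfold qJet
  split_ifs with h
  · have hle : ((n : ℤ) • y) κ' ≤ x κ' := by rw [← h.1]; exact smul_blk_apply_le n x κ'
    exact mul_nonneg (inv_nonneg.mpr (pow_pos hn 4).le) (gammaCoeff_nonneg_of_le κ' u hle)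
  · exact le_rfl

/-- [folklore] The jet is dominated by `n⁻⁴` times the indicator of the needle `{x : x_j = u_j ∀ j > κ′}`. -/
theorem qJet_le_indicator (y x : Site 4) :
    |qJet n κ' u y x| ≤ ((n : ℝ) ^ 4)⁻¹ * (if ∀ j : Fin 4, (κ' : ℕ) < j → x j = u j then 1 else 0) := by
  split_ifs with h
  · rw [mul_one]; exact abs_qJet_le_inv_pow_four n κ' u y x
  · push Not at h
    obtain ⟨j, hj, hne⟩ := h
    rw [qJet_eq_zero_of_upper_ne n κ' u j hj (Ne.symm hne) y, abs_zero, mul_zero]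

/-- [folklore] **THE NEEDLE COUNT IN A CUBE**: among the points `z` of the coordinate cube `{0,…,n−1}⁴`, those whose coordinates `j > κ′` are
pinned to prescribed integers number at most `n^{κ′+1}` (restriction to the `κ′+1` free coordinates is injective on them). -/
theorem card_needle_le (c : Fin 4 → ℤ) :
    ((Finset.univ.filter fun z : Fin 4 → Fin (n - 1 + 1) => ∀ j : Fin 4, (κ' : ℕ) < j → ((z j : ℕ) : ℤ) = c j).card : ℝ)
      ≤ (n : ℝ) ^ ((κ' : ℕ) + 1) := by
  have hn1 : n - 1 + 1 = n := Nat.sub_add_cancel (Nat.pos_of_ne_zero (NeZero.ne n))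
  set S := Finset.univ.filter fun z : Fin 4 → Fin (n - 1 + 1) => ∀ j : Fin 4, (κ' : ℕ) < j → ((z j : ℕ) : ℤ) = c j with hS
  -- restriction to the free coordinates `{j : (j:ℕ) < κ′+1}`
  let φ : (Fin 4 → Fin (n - 1 + 1)) → ({j : Fin 4 // (j : ℕ) < (κ' : ℕ) + 1} → Fin (n - 1 + 1)) := fun z j => z j.1
  have hinj : Set.InjOn φ (S : Set (Fin 4 → Fin (n - 1 + 1))) := by
    intro z hz z' hz' hφ
    rw [Finset.mem_coe, hS, Finset.mem_filter] at hz hz'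
    funext j
    by_cases hj : (j : ℕ) < (κ' : ℕ) + 1
    · exact congr_fun hφ ⟨j, hj⟩
    · have h1 := hz.2 j (by omega)
      have h2 := hz'.2 j (by omega)
      apply Fin.ext
      exact_mod_cast h1.trans h2.symm
  have hcard := Finset.card_le_card_of_injOn φ (fun z _ => Finset.mem_coe.2 (Finset.mem_univ (φ z))) hinj
  have hcod : (Finset.univ : Finset ({j : Fin 4 // (j : ℕ) < (κ' : ℕ) + 1} → Fin (n - 1 + 1))).card = n ^ ((κ' : ℕ) + 1) := by
    rw [Finset.card_univ, Fintype.card_fun, Fintype.card_fin, hn1, Fintype.card_fin_lt_of_le (by omega)]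
  rw [hcod] at hcard
  exact_mod_cast hcard

/-- [folklore] **THE NEEDLE WEIGHT OF ONE BACKGROUND BOND ON ITS BLOCK**: `Σ_{x ∈ B(y)} |qJet n κ′ u y x| ≤ n^{κ′+1}·(n⁴)⁻¹ = n^{κ′−3}` — an
axis-3 bond is met by the contours of at most `n⁴ · n⁻³`… i.e. the jet's block-`ℓ¹` mass is `1` for `κ′ = 3` down to `n⁻³` for `κ′ = 0`
(block `B6QGQLower276.B (n−1) y`, cube chart `sum_B`). -/
theorem sum_B_abs_qJet_le (y : Site 4) :
    ∑ x ∈ B (n - 1) y, |qJet n κ' u y x| ≤ (n : ℝ) ^ ((κ' : ℕ) + 1) * ((n : ℝ) ^ 4)⁻¹ := by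
  have hn : (0 : ℝ) < n := Nat.cast_pos.mpr (Nat.pos_of_ne_zero (NeZero.ne n))
  have hw : (0 : ℝ) ≤ ((n : ℝ) ^ 4)⁻¹ := inv_nonneg.mpr (pow_pos hn 4).le
  -- pinned values of the local coordinates above `κ′`: `z_j = u_j − n·y_j`
  set c : Fin 4 → ℤ := fun j => u j - (n : ℤ) * y j with hc
  have hchart : ∀ (z : Fin 4 → Fin (n - 1 + 1)) (j : Fin 4), chart (n - 1) y z j = u j ↔ ((z j : ℕ) : ℤ) = c j := by
    intro z j
    simp only [chart, side_pred, hc]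
    constructor <;> intro h <;> linarith
  calc ∑ x ∈ B (n - 1) y, |qJet n κ' u y x|
      ≤ ∑ x ∈ B (n - 1) y, ((n : ℝ) ^ 4)⁻¹ * (if ∀ j : Fin 4, (κ' : ℕ) < j → x j = u j then 1 else 0) :=
        Finset.sum_le_sum fun x _ => qJet_le_indicator n κ' u y x
    _ = ((n : ℝ) ^ 4)⁻¹ * ∑ z : Fin 4 → Fin (n - 1 + 1),
          (if ∀ j : Fin 4, (κ' : ℕ) < j → ((z j : ℕ) : ℤ) = c j then (1 : ℝ) else 0) := by
        rw [sum_B, ← Finset.mul_sum]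
        congr 1
        refine Finset.sum_congr rfl fun z _ => ?_
        have : (∀ j : Fin 4, (κ' : ℕ) < j → chart (n - 1) y z j = u j) ↔ (∀ j : Fin 4, (κ' : ℕ) < j → ((z j : ℕ) : ℤ) = c j) :=
          forall_congr' fun j => imp_congr_right fun _ => hchart z j
        simp only [this]
    _ = ((n : ℝ) ^ 4)⁻¹ *
          ((Finset.univ.filter fun z : Fin 4 → Fin (n - 1 + 1) => ∀ j : Fin 4, (κ' : ℕ) < j → ((z j : ℕ) : ℤ) = c j).card : ℝ) := by
        rw [Finset.sum_boole]
    _ ≤ ((n : ℝ) ^ 4)⁻¹ * (n : ℝ) ^ ((κ' : ℕ) + 1) := mul_le_mul_of_nonneg_left (card_needle_le n κ' c) hw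
    _ = (n : ℝ) ^ ((κ' : ℕ) + 1) * ((n : ℝ) ^ 4)⁻¹ := mul_comm _ _

end

end Summit.QuantumFields.BalabanUV.Beta.D1BFx.AveragingJetNeedle
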